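import Summits.BirchSwinnertonDyer.BirchSwinnertonDyer.Theorems.SemiOrdinaryEisensteinDescentShaTwoCochainBridgeLocal
import Literature.NumberTheory.GaloisRepresentations.HomDualShaTwoConnecting
import HarnessLib

/-!
# The Ш²-cochain bridge, instantiation (per place): the local data `η̃_v, φ_v` of `…ShaTwoCochainBridgeLocal` EXIST, and the
# idèle projection `π_v : J̄ → K̄_vˣ` is `θ_v`-equivariant and is `ι_v` on principal idèles (step S2-inst (L) of SHA2-BRIDGE-w3g7)

Route `SemiOrdinaryEisensteinDescent` (BSD), Kolyvagin column, Cassels–Tate lane: print item `CasselsTateLevelInputsFact`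
(stmt-BirchSwinnertonDyer-20191), last input `hPTc`.  Sequel of `…ShaTwoCochainBridgeLocal` (S2b, p635080: the local `2`-cocycle
of the bridge's admissible choice is `π Z` up to an explicit coboundary, GIVEN local data `η̃ : Hom(Y, K̄_vˣ)` with `η̃ ∘ i = π ∘ h̃`
and a continuous `φ : Γ_v → Hom(Z, K̄_vˣ)` with `φ(σ') ∘ p = π ∘ uJ ∘ ξ̃(θσ') − (σ'⋆η̃ − η̃)`) and of `…ShaTwoCochainBridgeData`
(S2-inst (G), p638692: the global data on road B's presentation).  Here the LOCAL data are PRODUCED, generically: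

* **`exists_bridgeLocalData`** — for a short exact `0 → X —i→ Y —p→ Z → 0` of `ℤ`-finite discrete `Γ_K`-modules, any
  discrete `Γ_K`-modules `U, J` with `uJ : U → J`, any field `E/K` with a `θ`-equivariant additive `π : J → K̄_Eˣ`
  (`θ = absGaloisRestrict K E`), and global data `h̃ : Hom(X, J)`, `ξ, ξ̃` with `uJ ∘ ξ(σ) = σ⋆h̃ − h̃`, `ξ̃(σ) ∘ i = ξ(σ)`
  (S2a's `hξ`, `hξt`): THERE ARE `η̃ : Hom(Y, K̄_Eˣ)` with `η̃ ∘ i = π ∘ h̃` and a continuous `φ : Γ_E → Hom(Z, K̄_Eˣ)` with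
  S2b's `hφ`.  Proof: `K̄_Eˣ` is divisible (`baer_unitsCarrier`), so `Hom(·, K̄_Eˣ)` of the restricted sequence is short exact
  (`isSES_restrict`, `isSES_dual`): `η̃` is any extension of `π ∘ h̃` along `i`; the `1`-cochain
  `N(σ') = π ∘ uJ ∘ ξ̃(θσ') − (σ'⋆η̃ − η̃) ∈ Hom(Y, K̄_Eˣ)` kills `i(X)` (by `hξ`, `hξt`, `η̃ ∘ i = π ∘ h̃` and the
  `θ`-equivariance of `π`), hence factors through `p` (`exact_mid`); `N` is continuous into a discrete space, so the factored
  cochain `φ` is continuous.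
* **`ideleProjection_toDGM_smul`**, **`ideleProjection_unitsToIdeleI`** — THE map of the application: an idèle projection
  `π_v : J̄ → K̄_vˣ` (`HomDual.IdeleProjection K v`, e.g. road B's `IdeleReadout.ideleProjection K v`) read on the discrete carrier
  `LCarrier (ideleBarD K)` is `θ_v`-equivariant for `toDGM (ideleBarD K)` (S2b's `hπ`) and equals the transfer
  `unitsTransfer K K_v : K̄ˣ → K̄_vˣ` on principal idèles `unitsToIdeleI K` (the dictionary used when the local invariants of
  `π_v Z` are compared with those of `K̄ˣ`-valued classes, memo §1 (iv)).

Width seat `bsd-wall-soed-p2-w3` g7; `--supports stmt-BirchSwinnertonDyer-20480`, helper.  THEOREMS ONLY (no `def`, no instance);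
no case of BSD, Poitou–Tate or Cassels–Tate is proved here.

## References
* [MilneADT2006] J. S. Milne, *Arithmetic Duality Theorems*, 2nd ed. (2006), I §0 (0.8), Thm. 4.10 (a) (proof, p. 58), Lemma 4.13.
* [NeukirchSchmidtWingberg2008] J. Neukirch, A. Schmidt, K. Wingberg, *Cohomology of Number Fields*, 2nd ed. (2008), (1.5.2), (8.1.1).
* [Weibel1994] C. Weibel, *An introduction to homological algebra* (1994), §2.3 (Baer's criterion).
-/

noncomputable section

-- `Summit.<P>.<Sub>` repeats `BirchSwinnertonDyer` by the tree's layout convention (D-0017)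
set_option linter.dupNamespace false
set_option autoImplicit false

namespace Summit.BirchSwinnertonDyer.BirchSwinnertonDyer.Theorems.ShaTwoCochain

open CategoryTheory NumberField
open Literature.NumberTheory.GaloisRepresentations Literature.NumberTheory.GaloisRepresentations.HomDual
open Literature.Algebra.Homology Literature.Algebra.Homology.DiscreteRep ContRepresentation Field Literature
open Literature.NumberTheory.GaloisRepresentations.DiscreteGaloisModule (units UnitsCarrier)
open Literature.NumberTheory.GaloisRepresentations.DGMBridge
open scoped ContRepresentation

/-! ## §1 The local data `η̃, φ` exist (generic) -/

section Generic

variable {K : Type} [Field K]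
variable {X Y Z U J : Type}
  [AddCommGroup X] [TopologicalSpace X] [DiscreteTopology X] [Module.Finite ℤ X]
  [AddCommGroup Y] [TopologicalSpace Y] [DiscreteTopology Y] [Module.Finite ℤ Y]
  [AddCommGroup Z] [TopologicalSpace Z] [DiscreteTopology Z] [Module.Finite ℤ Z]
  [AddCommGroup U] [TopologicalSpace U] [DiscreteTopology U]
  [AddCommGroup J] [TopologicalSpace J] [DiscreteTopology J]
variable {ρX : DiscreteGaloisModule K X} {ρY : DiscreteGaloisModule K Y} {ρZ : DiscreteGaloisModule K Z}
  {ρU : DiscreteGaloisModule K U} {ρJ : DiscreteGaloisModule K J}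

/-- **The local bridge data exist.**  For `0 → X —i→ Y —p→ Z → 0` short exact, `uJ : U → J`, a field `E/K`, a `θ`-equivariant
additive `π : J → K̄_Eˣ`, and global data `h̃, ξ, ξ̃` with `uJ (ξ σ x) = (σ⋆h̃) x − h̃ x` and `ξ̃ σ (i x) = ξ σ x`: there are
`η̃ : Hom(Y, K̄_Eˣ)` with `η̃ (i x) = π (h̃ x)` and a continuous `φ : Γ_E → Hom(Z, K̄_Eˣ)` with
`φ(σ') (p y) = π (uJ (ξ̃(θσ') y)) − ((σ'⋆η̃) y − η̃ y)` — verbatim the hypotheses `hηt`, `hφ` of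
`ShaTwoCochain.bridgeLocalCocycle_eq` / `dOne_bridgePrimitive` (with `U' := K̄_Eˣ`, `ρU' := units E`).
[cite: MilneADT2006, I §0 (0.8), Thm. 4.10 (a) (proof, p. 58)][cite: Weibel1994, §2.3] -/
theorem exists_bridgeLocalData
    (i : ρX.toContRepresentation →ⁱL ρY.toContRepresentation) (p : ρY.toContRepresentation →ⁱL ρZ.toContRepresentation)
    (hS : IsSES (toTopRepHom ρX ρY i) (toTopRepHom ρY ρZ p))
    (uJ : ρU.toContRepresentation →ⁱL ρJ.toContRepresentation)
    {E : Type} [Field E] [Algebra K E] (π : J →+ UnitsCarrier E)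
    (hπ : ∀ (σ' : absoluteGaloisGroup E) (j : J), π (ρJ (absGaloisRestrict K E σ') j) = units E σ' (π j))
    (ht : DiscreteRep.HomCarrier X J)
    (ξ : C(absoluteGaloisGroup K, DiscreteRep.HomCarrier X U))
    (ξt : C(absoluteGaloisGroup K, DiscreteRep.HomCarrier Y U))
    (hξ : ∀ (σ : absoluteGaloisGroup K) (x : X), uJ ((show X →ₗ[ℤ] U from ξ σ) x) =
      (show X →ₗ[ℤ] J from homGaloisModule ρX ρJ σ ht) x - (show X →ₗ[ℤ] J from ht) x)
    (hξt : ∀ (σ : absoluteGaloisGroup K) (x : X), (show Y →ₗ[ℤ] U from ξt σ) (i x) = (show X →ₗ[ℤ] U from ξ σ) x) :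
    ∃ (ηt : DiscreteRep.HomCarrier Y (UnitsCarrier E))
      (φ : C(absoluteGaloisGroup E, DiscreteRep.HomCarrier Z (UnitsCarrier E))),
      (∀ x : X, (show Y →ₗ[ℤ] UnitsCarrier E from ηt) (i x) = π ((show X →ₗ[ℤ] J from ht) x)) ∧
      (∀ (σ' : absoluteGaloisGroup E) (y : Y), (show Z →ₗ[ℤ] UnitsCarrier E from φ σ') (p y) =
        π (uJ ((show Y →ₗ[ℤ] U from ξt (absGaloisRestrict K E σ')) y)) -
          ((show Y →ₗ[ℤ] UnitsCarrier E from homGaloisModule (GaloisRep.restrictField E ρY) (units E) σ' ηt) y -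
            (show Y →ₗ[ℤ] UnitsCarrier E from ηt) y)) := by
  -- the dual of the restricted sequence against the divisible `K̄_Eˣ` is short exact
  have hD := isSES_dual (ρA := units E) (GaloisRep.restrictField E ρX) (GaloisRep.restrictField E ρY)
    (GaloisRep.restrictField E ρZ) (restrictIntertwining ρX ρY i) (restrictIntertwining ρY ρZ p)
    (isSES_restrict ρX ρY ρZ hS) (baer_unitsCarrier E)
  -- `η̃`: any extension of `π ∘ h̃` along `i`
  obtain ⟨ηt, hηt⟩ := hD.surjective
    (show DiscreteRep.HomCarrier X (UnitsCarrier E) from (π.comp (show X →ₗ[ℤ] J from ht).toAddMonoidHom).toIntLinearMap)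
  have hηt' : ∀ x : X, (show Y →ₗ[ℤ] UnitsCarrier E from ηt) (i x) = π ((show X →ₗ[ℤ] J from ht) x) := fun x =>
    congrArg (fun Φ : DiscreteRep.HomCarrier X (UnitsCarrier E) => (show X →ₗ[ℤ] UnitsCarrier E from Φ) x) hηt
  -- the `Hom(Y, K̄_Eˣ)`-valued `1`-cochain `N(σ') = π ∘ uJ ∘ ξ̃(θσ') − (σ'⋆η̃ − η̃)`, continuous (discrete target)
  let post : DiscreteRep.HomCarrier Y U → DiscreteRep.HomCarrier Y (UnitsCarrier E) := fun Φ =>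
    (show DiscreteRep.HomCarrier Y (UnitsCarrier E) from
      (π.comp ((uJ.toContinuousLinearMap.toLinearMap.toAddMonoidHom).comp (show Y →ₗ[ℤ] U from Φ).toAddMonoidHom)).toIntLinearMap)
  let T : C(absoluteGaloisGroup E, DiscreteRep.HomCarrier Y U × DiscreteRep.HomCarrier Y (UnitsCarrier E)) :=
    ⟨fun σ' => (ξt (absGaloisRestrict K E σ'), homGaloisModule (GaloisRep.restrictField E ρY) (units E) σ' ηt),
      (ξt.continuous.comp (absGaloisRestrict K E).continuous).prodMk
        ((homGaloisModule (GaloisRep.restrictField E ρY) (units E)).continuous_apply_left ηt)⟩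
  let G : DiscreteRep.HomCarrier Y U × DiscreteRep.HomCarrier Y (UnitsCarrier E) → DiscreteRep.HomCarrier Y (UnitsCarrier E) :=
    fun d => post d.1 - (d.2 - ηt)
  let N : C(absoluteGaloisGroup E, DiscreteRep.HomCarrier Y (UnitsCarrier E)) :=
    ⟨G ∘ T, (continuous_of_discreteTopology (f := G)).comp T.continuous⟩
  have hN : ∀ (σ' : absoluteGaloisGroup E) (y : Y), (show Y →ₗ[ℤ] UnitsCarrier E from N σ') y =
      π (uJ ((show Y →ₗ[ℤ] U from ξt (absGaloisRestrict K E σ')) y)) -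
        ((show Y →ₗ[ℤ] UnitsCarrier E from homGaloisModule (GaloisRep.restrictField E ρY) (units E) σ' ηt) y -
          (show Y →ₗ[ℤ] UnitsCarrier E from ηt) y) := fun _ _ => rfl
  -- `N(σ')` kills `i(X)`
  have hNi : ∀ σ' : absoluteGaloisGroup E,
      (dualG (GaloisRep.restrictField E ρX) (GaloisRep.restrictField E ρY) (units E) (restrictIntertwining ρX ρY i)).hom
        (N σ') = 0 := by
    intro σ'
    change (show X →ₗ[ℤ] UnitsCarrier E from precomp (GaloisRep.restrictField E ρX) (GaloisRep.restrictField E ρY) (units E)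
      (restrictIntertwining ρX ρY i) (N σ')) = (0 : X →ₗ[ℤ] UnitsCarrier E)
    refine LinearMap.ext fun x => ?_
    rw [precomp_apply_apply, restrictIntertwining_apply, LinearMap.zero_apply, hN, hξt, hξ, map_sub, hηt',
      sub_sub_sub_cancel_right, sub_eq_zero]
    -- `π ((θσ'⋆h̃) x) = (σ'⋆η̃)(i x)`: both are `σ' (π (h̃ ((θσ')⁻¹ x)))`
    change π (ρJ (absGaloisRestrict K E σ') ((show X →ₗ[ℤ] J from ht) (ρX (absGaloisRestrict K E σ')⁻¹ x))) =
      units E σ' ((show Y →ₗ[ℤ] UnitsCarrier E from ηt) ((GaloisRep.restrictField E ρY) σ'⁻¹ (i x)))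
    rw [hπ, GaloisRep.restrictField_apply, map_inv (absGaloisRestrict K E) σ', ← intertwining_apply_smul i, hηt']
  -- factor `N(σ')` through `p` (exactness in the middle), continuously (choice on a discrete space)
  have hex : ∀ σ' : absoluteGaloisGroup E, ∃ Φ : DiscreteRep.HomCarrier Z (UnitsCarrier E),
      (dualF (GaloisRep.restrictField E ρY) (GaloisRep.restrictField E ρZ) (units E) (restrictIntertwining ρY ρZ p)).hom Φ =
        N σ' := fun σ' => hD.exact_mid (N σ') (hNi σ')
  classical
  let ψ : DiscreteRep.HomCarrier Y (UnitsCarrier E) → DiscreteRep.HomCarrier Z (UnitsCarrier E) := fun Gy =>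
    if h : ∃ Φ : DiscreteRep.HomCarrier Z (UnitsCarrier E),
        (dualF (GaloisRep.restrictField E ρY) (GaloisRep.restrictField E ρZ) (units E) (restrictIntertwining ρY ρZ p)).hom Φ = Gy
      then h.choose else 0
  have hψ : ∀ σ' : absoluteGaloisGroup E,
      (dualF (GaloisRep.restrictField E ρY) (GaloisRep.restrictField E ρZ) (units E) (restrictIntertwining ρY ρZ p)).hom
        (ψ (N σ')) = N σ' := by
    intro σ'
    simp only [ψ, dif_pos (hex σ')]
    exact (hex σ').choose_spec
  refine ⟨ηt, ⟨ψ ∘ N, (continuous_of_discreteTopology (f := ψ)).comp N.continuous⟩, hηt', fun σ' y => ?_⟩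
  have e := congrArg (fun Φ : DiscreteRep.HomCarrier Y (UnitsCarrier E) => (show Y →ₗ[ℤ] UnitsCarrier E from Φ) y) (hψ σ')
  rw [← hN σ' y]
  exact e

end Generic

/-! ## §2 THE projection: `π_v` on the discrete carrier of `J̄` -/

section Projection

variable {K : Type} [Field K] [NumberField K] {v : Place K} (π : HomDual.IdeleProjection K v)

/-- **`π_v` is `θ_v`-equivariant on `LCarrier (ideleBarD K)`** (hypothesis `hπ` of S2b for `ρJ := toDGM (ideleBarD K)`,
`ρU' := units K_v`). [cite: MilneADT2006, I Lemma 4.13 (proof)] -/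
theorem ideleProjection_toDGM_smul (σ' : absoluteGaloisGroup (Place.Completion v)) (j : LCarrier (ideleBarD K)) :
    (π.toAddMonoidHom.comp (LCarrier.val (ideleBarD K)))
        (toDGM (ideleBarD K) (absGaloisRestrict K (Place.Completion v) σ') j) =
      units (Place.Completion v) σ' ((π.toAddMonoidHom.comp (LCarrier.val (ideleBarD K))) j) := by
  rw [AddMonoidHom.comp_apply, AddMonoidHom.comp_apply, toDGM_apply, LCarrier.val_of, ← π.map_rep]

/-- **`π_v` is the transfer `ι_v : K̄ˣ → K̄_vˣ` on principal idèles**: `π_v (unitsToIdeleI K u) = unitsTransfer K K_v u`.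
[cite: MilneADT2006, I Lemma 4.13 (proof)] -/
theorem ideleProjection_unitsToIdeleI (u : UnitsCarrier K) :
    (π.toAddMonoidHom.comp (LCarrier.val (ideleBarD K))) (unitsToIdeleI K u) =
      unitsTransfer K (Place.Completion v) u := by
  rw [AddMonoidHom.comp_apply, unitsToIdeleI_apply, LCarrier.val_of, π.map_unitsToIdele, AddEquiv.apply_symm_apply,
    unitsTransfer_apply]

end Projection

end Summit.BirchSwinnertonDyer.BirchSwinnertonDyer.Theorems.ShaTwoCochain

end
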